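import Summits.QuantumFields.YangMills.Theorems.BalabanUVNodesN15CurvedLaplacianSpecies
import HarnessLib

/-!
# Route «BalabanUVNodes» (cluster K4 «SpineRates»), Track-A DAG node N15 = NE2, BACKGROUND LAYER — THE TRANSPORTER-FORM LETTERS OF THE CURVED SPECIES DISCHARGED FROM
# (3.37)-SHAPED GENERATOR LETTERS through the exponential transport `S_μ(x) = coordMat e (exp(η Z_μ(x)))` (n15-b 13a∕13b∕16, dag-n15-c FILE 28's `gaugeTransport` at `Z = ad A`):
# the field letter `|S − 1| ≤ η·κ_e e r`, the covariant-gradient letter `|S_μ − R₋ᵀS₋R₋| ≤ η²·κ_e(e g + e²(2 + e) r r_B)` at a CURVED base point `R = exp(ηW)`, and the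
# plain η-fit of `a⁺ = η⁻¹(S − 1) = coordMat e (Φ₁(η, Z))`

Cell `pub-ymgap`, seat `pub-ymgap-dag-n15-w3` (WIDTH SEAT 3∕3 on node N15, director-ym №197 ∕ HUMAN RULING D-0149; plan g77 `W-SEAT-START-LIST.md` §n15 item 3
«`NE2PlusOperator` for the background layer at GENERAL small-field U» — fifth piece).  `bears_on: R4∕N15 · K3⁷ SpineGivenEndpointR13SepCoPH (stmt-QuantumFields-20544)`.
Filed `--kind proof --supports stmt-QuantumFields-20544 --as helper` — COUNT-NEUTRAL.  Imports BY NAME this seat's file 1 `…N15CurvedLaplacianSpecies` (p583814: `curvCoefA`,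
`covShiftDefect`; through it dag-n15-c FILE 28 `coordMat_one`, `coordMat_add`, `Phi1_eq_smul`, FILE 25 `coordMat_smul`, n15-b parts 13a∕13b∕16∕18: `Phi0`, `Phi1`, `Phi0_zero`,
`Phi0_lipschitz`, `Phi0_consistency`, `norm_smul_le_of_regime`, `fit_Phi1`, `coordMat`, `basisConst`, `coordMat_sub`, `row_abs_sum_coordMat_le`); nothing in the tree is modified.

WHY.  Files 1–4 of this seat (p583814 · p585823 · p586904 · p587618) state Bałaban's (3.52)–(3.65) at a CURVED base point over TWO TRANSPORTER-FORM LETTERS of the perturbation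
`S` — `|S_μ(x) − 1| ≤ ηp` (field) and `|S_μ(x) − R₋ᵀS_μ(x − e_μ)R₋| ≤ η²q` (covariant gradient along the background `R`) — plus, for the η-defect, the fits of `a⁺ = η⁻¹(S − 1)`.
[Balaban1985BackgroundPropagators] (3.37) p. 396 states the perturbation through its GENERATOR: *«U′ = e^{iηA′}, A′ 𝔤ᶜ-valued, |A′| < α₁(L^jη)^{−1}, |∇^η_U A′| < α₁(L^jη)^{−2} on
Ω_j»*; the lineage models `exp(iη ad_{A′})` by `coordMat e (Phi0 η Z)`, `Z = adCLM ℝ (A′(b))` on a complete normed algebra `𝔄 ≅ ℝ^ι` (n15-b 13a∕13b∕16; FILE 28 `gaugeTransport`).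
THIS FILE DISCHARGES the transporter-form letters from generator letters of the (3.37) shape — `‖Z_μ(x)‖ ≤ r` (field), `‖Z_μ(x) − Z_μ(x − e_μ)‖ ≤ ηg` (lattice gradient), background
generators `‖W_μ(x)‖ ≤ r_B`, regimes `ηr ≤ 1`, `ηr_B ≤ 1` (the print's «Mα₀ small») — so that files 1–4's hypotheses are inhabited by the print's shapes:

* §1 coordinates: ★ `coordMat_mul` (`coordMat e (T₁T₂) = coordMat e T₁ · coordMat e T₂` — the coordinate map is multiplicative), `abs_coordMat_entry_le` (`|coordMat e T _{ij}| ≤ κ_e‖T‖`);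
* §2 `expTrField e η Z` (def: `μ x ↦ coordMat e (Phi0 η (Z μ x))`, FILE 28's `gaugeTransport … (inl μ)` at `Z = ad A`); ★★ `transporterLetter_exp` (`|S − 1| ≤ η·(κ_e·e·r)`);
  `curvCoefA_inl_exp_eq` (`a⁺ = coordMat e (Φ₁(η, Z))`), ★ `fieldLetter_curvCoefA_exp` (`|a⁺| ≤ κ_e·e·r`); ★ `fit_curvCoefA_inl_exp` (the plain η-fit of `a⁺` between two spacings
  `0 < η′ ≤ η ≤ η₀` from the generator fit `‖Z′(x′) − Z(πx′)‖ ≤ o`: `≤ κ_e(e·o + 2e r²·η)` — file 4's `o_a`, rate one, n15-b `fit_Phi1`); `fitTranslated_curvCoefA_inl_exp`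
  (file 4's `o_t`, same at the translated points) and `fitTranslated_expTrField` (file 4's `o_R ≤ 2η·κ_e e r_B`: both background transporters are `η`-close to `1`);
* §3 ★ `conj_defect_identity` (`M − PMQ = −((P − 1)(M − 1)Q + (M − 1)(Q − 1))` for `PQ = 1`), `Phi0_neg_mul_Phi0` (`e^{−ηW}e^{ηW} = 1`), ★★★ `covShiftLetter_exp`: at the curved base point
  `R = expTrField e η W` under the orthogonal model's identification `R₋ᵀ = coordMat e (e^{−ηW₋})` (hypothesis `hRt` — the transpose IS the inverse transport), the covariant-gradient
  letter `|S_μ(x) − R₋ᵀS₋R₋| ≤ η²·κ_e·(e·g + e²(2 + e)·r·r_B)` — SECOND ORDER: Duhamel–Lipschitz for the gradient term plus the conjugation defect `e^{−ηW}e^{ηZ}e^{ηW} − e^{ηZ} = O(η²rr_B)`.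

HONEST FRAMING ∕ LIMITS.  Letters over the lineage's `exp`∕coordinate species ([B9] (3.37) p. 396, (3.50) p. 400 = SHAPES; nothing of [B9] asserted); the ORTHOGONALITY of the coordinate
transporters (`SSᵀ = 1`, `RRᵀ = RᵀR = 1`, `Rᵀ = e^{−ηW}` in coordinates) remains the MODEL hypothesis of files 1–4 (it holds for an `ℓ²`-orthonormal `e` and skew `Z`, not derived for a
general `e`); crude constants; the covariant-gradient FIT `o_g` of file 4 (second-order Taylor of the conjugated exponentials) is NOT typed here.  NE2⁺ NOT PRINTED, NOT proved;
N15 NOT discharged; counts of record UNMOVED (typed 28∕28 · discharged 5∕27); one finite 𝕋⁴ at fixed ε — NOT infinite volume, NOT OS on ℝ⁴, NOT a mass gap, NOT Clay; R4 closes the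
conditional finite-𝕋⁴ rung `BalabanLadder.UV` only.  Restate-immune (no Theses import).
-/

set_option autoImplicit false

noncomputable section
open scoped BigOperators Matrix
open Finset NormedSpace

namespace Summit.QuantumFields.YangMills.BalabanUVNodes.N15.CurvedSpecies

open Summit.QuantumFields.YangMills.BalabanUVNodes.N15.MatrixSpecies (Phi0 Phi1 Phi0_zero Phi0_lipschitz Phi0_consistency norm_smul_le_of_regime fit_Phi1 coordMat basisConst
  basisConst_nonneg coordMat_sub row_abs_sum_coordMat_le)
open Summit.QuantumFields.YangMills.BalabanUVNodes.N15.BackgroundLayer (coordMat_one coordMat_smul Phi1_eq_smul)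

variable {X X' ι J : Type} [Fintype ι] [DecidableEq ι] {𝔄 : Type} [NormedRing 𝔄] [NormedAlgebra ℝ 𝔄] [CompleteSpace 𝔄] (e : 𝔄 ≃L[ℝ] (ι → ℝ))

/-! ## §1 Coordinates are multiplicative; entry letters from operator norms -/

section Coordinates

omit [CompleteSpace 𝔄] in
/-- ★ THE COORDINATE MAP IS MULTIPLICATIVE: `coordMat e (T₁T₂) = coordMat e T₁ · coordMat e T₂` (`e⁻¹e = id` between the factors). [folklore] -/
theorem coordMat_mul (T₁ T₂ : 𝔄 →L[ℝ] 𝔄) : coordMat e (T₁ * T₂) = coordMat e T₁ * coordMat e T₂ := by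
  unfold coordMat
  rw [← LinearMap.toMatrix'_mul]
  congr 1
  apply LinearMap.ext
  intro v
  simp [Module.End.mul_apply]

omit [CompleteSpace 𝔄] in
/-- ENTRY LETTER IN COORDINATES: `|coordMat e T _{ij}| ≤ κ_e·‖T‖` (part 16's row-sum letter, one term). [folklore] -/
theorem abs_coordMat_entry_le (T : 𝔄 →L[ℝ] 𝔄) (i j : ι) : |coordMat e T i j| ≤ basisConst e * ‖T‖ :=
  (Finset.single_le_sum (f := fun j => |coordMat e T i j|) (fun _ _ => abs_nonneg _) (Finset.mem_univ j)).trans (row_abs_sum_coordMat_le e T i)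

omit [CompleteSpace 𝔄] in
/-- Entry letter of a coordinate difference `coordMat e T₁ − coordMat e T₂`. [folklore] -/
theorem abs_coordMat_sub_entry_le (T₁ T₂ : 𝔄 →L[ℝ] 𝔄) (i j : ι) : |(coordMat e T₁ - coordMat e T₂) i j| ≤ basisConst e * ‖T₁ - T₂‖ := by
  rw [← coordMat_sub]; exact abs_coordMat_entry_le e _ i j

end Coordinates

/-! ## §2 The exponential transporter field: the field letter, the forward coefficient and its η-fit -/

section Field

variable (η : ℝ) (Z : J → X → (𝔄 →L[ℝ] 𝔄))

/-- THE EXPONENTIAL TRANSPORTER FIELD in coordinates: `S_μ(x) = coordMat e (e^{ηZ_μ(x)})` — FILE 28's `gaugeTransport … (inl μ)` at `Z = adCLM ℝ (A μ x)` (the print's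
`exp(iη ad_{A′(b)})`), here for any generator field `Z`. [cite: Balaban1985BackgroundPropagators, (3.37) p.396, (3.50) p.400 (shape)] -/
def expTrField : J → X → Matrix ι ι ℝ := fun μ x => coordMat e (Phi0 η (Z μ x))

omit [CompleteSpace 𝔄] in
/-- Unfolding. [folklore] -/
theorem expTrField_apply (μ : J) (x : X) : expTrField e η Z μ x = coordMat e (Phi0 η (Z μ x)) := rfl

/-- ★★ **THE FIELD LETTER FROM THE GENERATOR LETTER**: `‖Z_μ(x)‖ ≤ r`, `0 ≤ η`, `ηr ≤ 1` ⟹ `|(S_μ(x) − 1)_{ij}| ≤ η·(κ_e·e·r)` (13b `Phi0_consistency`: `‖e^{ηZ} − 1‖ ≤ e·r·η`).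
[cite: Balaban1985BackgroundPropagators, (3.37) p.396 (shape)] -/
theorem transporterLetter_exp {r : ℝ} (hη : 0 ≤ η) (hreg : η * r ≤ 1) (hZ : ∀ μ x, ‖Z μ x‖ ≤ r) (μ : J) (x : X) (i j : ι) :
    |(expTrField e η Z μ x - 1) i j| ≤ η * (basisConst e * Real.exp 1 * r) := by
  have h := Phi0_consistency (𝔸 := 𝔄 →L[ℝ] 𝔄) hreg η hη le_rfl (Z μ x) (hZ μ x)
  rw [Phi0_zero] at h
  rw [expTrField_apply, ← coordMat_one (e := e), ← coordMat_sub]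
  calc |coordMat e (Phi0 η (Z μ x) - 1) i j| ≤ basisConst e * ‖Phi0 η (Z μ x) - 1‖ := abs_coordMat_entry_le e _ i j
    _ ≤ basisConst e * (Real.exp 1 * r * η) := mul_le_mul_of_nonneg_left h (basisConst_nonneg e)
    _ = η * (basisConst e * Real.exp 1 * r) := by ring

variable (τ : J → X ≃ X) (R : J → X → Matrix ι ι ℝ)

omit [CompleteSpace 𝔄] in
/-- THE FORWARD COEFFICIENT IS `Φ₁` IN COORDINATES: `a⁺_μ(x) = η⁻¹(S_μ(x) − 1) = coordMat e (Φ₁(η, Z_μ(x)))` (`η ≠ 0`; FILE 28 `Phi1_eq_smul`). [folklore] -/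
theorem curvCoefA_inl_exp_eq (hη : η ≠ 0) (μ : J) (x : X) :
    curvCoefA η τ R (expTrField e η Z) (Sum.inl μ) x = coordMat e (Phi1 η (Z μ x)) := by
  rw [curvCoefA_inl, expTrField_apply, Phi1_eq_smul hη, coordMat_smul, coordMat_sub, coordMat_one]

/-- ★ **THE FIELD LETTER OF `a⁺`**: `|a⁺_μ(x)_{ij}| ≤ κ_e·e·r` (`0 < η`, `ηr ≤ 1`, `‖Z‖ ≤ r`) — file 4's `p`. [cite: Balaban1985BackgroundPropagators, (3.37) p.396 (shape)] -/
theorem fieldLetter_curvCoefA_exp {r : ℝ} (hη : 0 < η) (hreg : η * r ≤ 1) (hZ : ∀ μ x, ‖Z μ x‖ ≤ r) (μ : J) (x : X) (i j : ι) :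
    |curvCoefA η τ R (expTrField e η Z) (Sum.inl μ) x i j| ≤ basisConst e * Real.exp 1 * r := by
  rw [curvCoefA_inl, Matrix.smul_apply, smul_eq_mul, abs_mul, abs_of_pos (inv_pos.mpr hη)]
  calc η⁻¹ * |(expTrField e η Z μ x - 1) i j| ≤ η⁻¹ * (η * (basisConst e * Real.exp 1 * r)) :=
        mul_le_mul_of_nonneg_left (transporterLetter_exp e η Z hη.le hreg hZ μ x i j) (inv_pos.mpr hη).le
    _ = basisConst e * Real.exp 1 * r := by field_simp

variable (η' : ℝ) (Z' : J → X' → (𝔄 →L[ℝ] 𝔄)) (τ' : J → X' ≃ X') (R' : J → X' → Matrix ι ι ℝ) (π : X' → X)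

/-- ★ **THE PLAIN η-FIT OF `a⁺` FROM THE GENERATOR FIT** (file 4's `o_a`, RATE ONE): for spacings `0 < η′ ≤ η ≤ η₀`, `η₀r ≤ 1`, generators `‖Z‖, ‖Z′‖ ≤ r` and the generator fit
`‖Z′_μ(x′) − Z_μ(πx′)‖ ≤ o`: `|a⁺′_μ(x′) − a⁺_μ(πx′)|_{ij} ≤ κ_e·(e·o + 2e r²·η)` (n15-b 13b `fit_Phi1`). [cite: Balaban1985BackgroundPropagators, (3.37) p.396, (3.50)–(3.52) p.400 (shapes)] -/
theorem fit_curvCoefA_inl_exp {η₀ r o : ℝ} (hreg : η₀ * r ≤ 1) (hη' : 0 < η') (hη'η : η' ≤ η) (hηη₀ : η ≤ η₀) (hZ' : ∀ μ x', ‖Z' μ x'‖ ≤ r) (hZ : ∀ μ x, ‖Z μ x‖ ≤ r)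
    (hfit : ∀ μ x', ‖Z' μ x' - Z μ (π x')‖ ≤ o) (μ : J) (x' : X') (i j : ι) :
    |(curvCoefA η' τ' R' (expTrField e η' Z') (Sum.inl μ) x' - curvCoefA η τ R (expTrField e η Z) (Sum.inl μ) (π x')) i j| ≤
      basisConst e * (Real.exp 1 * o + 2 * (Real.exp 1 * r ^ 2) * η) := by
  have hη : 0 < η := lt_of_lt_of_le hη' hη'η
  rw [curvCoefA_inl_exp_eq e η' Z' τ' R' hη'.ne' μ x', curvCoefA_inl_exp_eq e η Z τ R hη.ne' μ (π x')]
  have h := fit_Phi1 (𝔸 := 𝔄 →L[ℝ] 𝔄) π hreg hη'.le hη'η hηη₀ (a' := Z' μ) (a := Z μ) (hZ' μ) (hZ μ) (o := fun _ => o) (fun x' => hfit μ x') x'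
  exact (abs_coordMat_sub_entry_le e _ _ i j).trans (mul_le_mul_of_nonneg_left h (basisConst_nonneg e))

/-- THE TRANSLATED η-FIT OF `a⁺` (file 4's `o_t`): the same estimate at the translated pair of points `((τ′_μ)⁻¹x′, (τ_μ)⁻¹(πx′))` from the translated generator fit
`‖Z′_μ((τ′_μ)⁻¹x′) − Z_μ((τ_μ)⁻¹(πx′))‖ ≤ o_t`. [cite: Balaban1985BackgroundPropagators, (3.37) p.396 (shape)] -/
theorem fitTranslated_curvCoefA_inl_exp {η₀ r ot : ℝ} (hreg : η₀ * r ≤ 1) (hη' : 0 < η') (hη'η : η' ≤ η) (hηη₀ : η ≤ η₀) (hZ' : ∀ μ x', ‖Z' μ x'‖ ≤ r)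
    (hZ : ∀ μ x, ‖Z μ x‖ ≤ r) (hfit : ∀ μ x', ‖Z' μ ((τ' μ).symm x') - Z μ ((τ μ).symm (π x'))‖ ≤ ot) (μ : J) (x' : X') (i j : ι) :
    |(curvCoefA η' τ' R' (expTrField e η' Z') (Sum.inl μ) ((τ' μ).symm x') - curvCoefA η τ R (expTrField e η Z) (Sum.inl μ) ((τ μ).symm (π x'))) i j| ≤
      basisConst e * (Real.exp 1 * ot + 2 * (Real.exp 1 * r ^ 2) * η) := by
  have hη : 0 < η := lt_of_lt_of_le hη' hη'η
  rw [curvCoefA_inl_exp_eq e η' Z' τ' R' hη'.ne' μ, curvCoefA_inl_exp_eq e η Z τ R hη.ne' μ]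
  have h := fit_Phi1 (𝔸 := 𝔄 →L[ℝ] 𝔄) π hreg hη'.le hη'η hηη₀ (a' := Z' μ ∘ (τ' μ).symm) (a := Z μ ∘ (τ μ).symm) (fun x' => hZ' μ _) (fun x => hZ μ _)
    (o := fun _ => ot) (fun x' => hfit μ x') x'
  exact (abs_coordMat_sub_entry_le e _ _ i j).trans (mul_le_mul_of_nonneg_left h (basisConst_nonneg e))

/-- THE TRANSLATED η-FIT OF THE BACKGROUND TRANSPORTERS (file 4's `o_R`) is TRIVIALLY of rate one in `η`: both transporters are `η`-close to `1`
(`|R′ − 1| ≤ η′κ_ee r_B`, `|R̄ − 1| ≤ ηκ_ee r_B`, `η′ ≤ η`), hence `|R′_μ((τ′_μ)⁻¹x′) − R_μ((τ_μ)⁻¹(πx′))|_{ij} ≤ 2η·κ_e·e·r_B`. [cite: Balaban1985BackgroundPropagators, (3.35) p.396 (shape)] -/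
theorem fitTranslated_expTrField {rB : ℝ} (W : J → X → (𝔄 →L[ℝ] 𝔄)) (W' : J → X' → (𝔄 →L[ℝ] 𝔄)) (hη' : 0 ≤ η') (hη'η : η' ≤ η) (hregB : η * rB ≤ 1)
    (hW : ∀ μ x, ‖W μ x‖ ≤ rB) (hW' : ∀ μ x', ‖W' μ x'‖ ≤ rB) (μ : J) (x' : X') (i j : ι) :
    |(expTrField e η' W' μ ((τ' μ).symm x') - expTrField e η W μ ((τ μ).symm (π x'))) i j| ≤ 2 * η * (basisConst e * Real.exp 1 * rB) := by
  have hrB : 0 ≤ rB := (norm_nonneg _).trans (hW μ ((τ μ).symm (π x')))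
  have hη : 0 ≤ η := hη'.trans hη'η
  have hregB' : η' * rB ≤ 1 := (mul_le_mul_of_nonneg_right hη'η hrB).trans hregB
  have h1 := transporterLetter_exp e η' W' hη' hregB' hW' μ ((τ' μ).symm x') i j
  have h2 := transporterLetter_exp e η W hη hregB hW μ ((τ μ).symm (π x')) i j
  have hsplit : (expTrField e η' W' μ ((τ' μ).symm x') - expTrField e η W μ ((τ μ).symm (π x'))) i j =
      (expTrField e η' W' μ ((τ' μ).symm x') - 1) i j - (expTrField e η W μ ((τ μ).symm (π x')) - 1) i j := by
    simp only [Matrix.sub_apply]; ring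
  rw [hsplit]
  have hK : 0 ≤ basisConst e * Real.exp 1 * rB := by have := basisConst_nonneg e; positivity
  calc |(expTrField e η' W' μ ((τ' μ).symm x') - 1) i j - (expTrField e η W μ ((τ μ).symm (π x')) - 1) i j|
      ≤ |(expTrField e η' W' μ ((τ' μ).symm x') - 1) i j| + |(expTrField e η W μ ((τ μ).symm (π x')) - 1) i j| := abs_sub _ _
    _ ≤ η' * (basisConst e * Real.exp 1 * rB) + η * (basisConst e * Real.exp 1 * rB) := add_le_add h1 h2
    _ ≤ η * (basisConst e * Real.exp 1 * rB) + η * (basisConst e * Real.exp 1 * rB) := by gcongr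
    _ = 2 * η * (basisConst e * Real.exp 1 * rB) := by ring

end Field

/-! ## §3 The covariant-gradient letter at a curved base point -/

section Gradient

/-- `e^{η(−W)}·e^{ηW} = 1` in a complete real normed algebra (the generators commute; `exp` read over `ℚ` by restriction of scalars). [folklore] -/
theorem Phi0_neg_mul_Phi0 {𝔅 : Type} [NormedRing 𝔅] [NormedAlgebra ℝ 𝔅] [CompleteSpace 𝔅] (η : ℝ) (W : 𝔅) : Phi0 η (-W) * Phi0 η W = 1 := by
  letI : NormedAlgebra ℚ 𝔅 := NormedAlgebra.restrictScalars ℚ ℝ 𝔅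
  unfold Phi0
  rw [smul_neg, ← exp_add_of_commute (Commute.neg_left (Commute.refl (η • W))), neg_add_cancel, exp_zero]

/-- ★ THE CONJUGATION-DEFECT IDENTITY: `PQ = 1 ⟹ M − PMQ = −((P − 1)(M − 1)Q + (M − 1)(Q − 1))` — the defect is bilinear in `M − 1` and `P − 1`, `Q − 1`. [folklore] -/
theorem conj_defect_identity {𝔅 : Type} [Ring 𝔅] {P M Q : 𝔅} (hPQ : P * Q = 1) : M - P * M * Q = -((P - 1) * (M - 1) * Q + (M - 1) * (Q - 1)) := by
  have h : (P - 1) * (M - 1) * Q + (M - 1) * (Q - 1) = P * M * Q - P * Q - M * Q + Q + (M * Q - M - Q + 1) := by noncomm_ring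
  rw [h, hPQ]
  noncomm_ring

/-- Norm of the conjugation defect: `‖M − PMQ‖ ≤ ‖P − 1‖‖M − 1‖‖Q‖ + ‖M − 1‖‖Q − 1‖` for `PQ = 1`. [folklore] -/
theorem norm_conj_defect_le {𝔅 : Type} [NormedRing 𝔅] {P M Q : 𝔅} (hPQ : P * Q = 1) :
    ‖M - P * M * Q‖ ≤ ‖P - 1‖ * ‖M - 1‖ * ‖Q‖ + ‖M - 1‖ * ‖Q - 1‖ := by
  rw [conj_defect_identity hPQ, norm_neg]
  exact (norm_add_le _ _).trans (add_le_add ((norm_mul_le _ _).trans (mul_le_mul_of_nonneg_right (norm_mul_le _ _) (norm_nonneg _))) (norm_mul_le _ _))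

variable (η : ℝ) (τ : J → X ≃ X) (Z W : J → X → (𝔄 →L[ℝ] 𝔄))

/-- ★★★ **THE COVARIANT-GRADIENT LETTER AT A CURVED BASE POINT FROM GENERATOR LETTERS.**  Background `R = expTrField e η W` (`‖W‖ ≤ r_B`) in the orthogonal model, with the transpose
identified with the inverse transport (`hRt : R_μ(y)ᵀ = coordMat e (e^{−ηW_μ(y)})`); perturbation `S = expTrField e η Z` with `‖Z‖ ≤ r` and the lattice-gradient letter
`‖Z_μ(x) − Z_μ(x − e_μ)‖ ≤ ηg`; regimes `0 ≤ η`, `ηr ≤ 1`, `ηr_B ≤ 1`.  Then `|(S_μ(x) − R₋ᵀS_μ(x − e_μ)R₋)_{ij}| ≤ η²·κ_e·(e·g + e²(2 + e)·r·r_B)` — SECOND ORDER: the gradient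
term by Duhamel–Lipschitz (13b `Phi0_lipschitz`), the transport term by the conjugation defect `e^{−ηW}e^{ηZ}e^{ηW} − e^{ηZ}`. [cite: Balaban1985BackgroundPropagators, (3.37) p.396 (`|∇^η_U A′|`: shape), (3.52) p.400 (`D^{η*}_U A′`: shape)] -/
theorem covShiftLetter_exp {r rB g : ℝ} (hη : 0 ≤ η) (hreg : η * r ≤ 1) (hregB : η * rB ≤ 1) (hZ : ∀ μ x, ‖Z μ x‖ ≤ r) (hW : ∀ μ x, ‖W μ x‖ ≤ rB)
    (hgrad : ∀ μ x, ‖Z μ x - Z μ ((τ μ).symm x)‖ ≤ η * g) (hRt : ∀ μ y, (expTrField e η W μ y)ᵀ = coordMat e (Phi0 η (-(W μ y)))) (μ : J) (x : X) (i j : ι) :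
    |covShiftDefect τ (expTrField e η W) (expTrField e η Z) μ x i j| ≤
      η ^ 2 * (basisConst e * (Real.exp 1 * g + Real.exp 1 ^ 2 * (2 + Real.exp 1) * r * rB)) := by
  set y := (τ μ).symm x with hy
  have hr : 0 ≤ r := (norm_nonneg _).trans (hZ μ x)
  have hrB : 0 ≤ rB := (norm_nonneg _).trans (hW μ x)
  have he : 0 ≤ Real.exp 1 := (Real.exp_pos 1).le
  -- the defect in 𝔄
  set M := Phi0 η (Z μ y) with hM
  set P := Phi0 η (-(W μ y)) with hP
  set Q := Phi0 η (W μ y) with hQ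
  have hPQ : P * Q = 1 := Phi0_neg_mul_Phi0 η (W μ y)
  have hcoord : covShiftDefect τ (expTrField e η W) (expTrField e η Z) μ x = coordMat e (Phi0 η (Z μ x) - P * M * Q) := by
    rw [covShiftDefect, ← hy, hRt μ y, expTrField_apply, expTrField_apply, expTrField_apply, ← hP, ← hM, ← hQ, ← coordMat_mul, ← coordMat_mul, ← coordMat_sub]
  -- the two terms
  have hT1 : ‖Phi0 η (Z μ x) - M‖ ≤ Real.exp 1 * η * (η * g) := by
    have h := Phi0_lipschitz (𝔸 := 𝔄 →L[ℝ] 𝔄) hreg η hη le_rfl (Z μ x) (Z μ y) (hZ μ x) (hZ μ y)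
    exact h.trans (mul_le_mul_of_nonneg_left (hgrad μ x) (by positivity))
  have hM1 : ‖M - 1‖ ≤ Real.exp 1 * r * η := by
    have h := Phi0_consistency (𝔸 := 𝔄 →L[ℝ] 𝔄) hreg η hη le_rfl (Z μ y) (hZ μ y); rwa [Phi0_zero] at h
  have hP1 : ‖P - 1‖ ≤ Real.exp 1 * rB * η := by
    have h := Phi0_consistency (𝔸 := 𝔄 →L[ℝ] 𝔄) hregB η hη le_rfl (-(W μ y)) (by rw [norm_neg]; exact hW μ y); rwa [Phi0_zero] at h
  have hQ1 : ‖Q - 1‖ ≤ Real.exp 1 * rB * η := by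
    have h := Phi0_consistency (𝔸 := 𝔄 →L[ℝ] 𝔄) hregB η hη le_rfl (W μ y) (hW μ y); rwa [Phi0_zero] at h
  have hQn : ‖Q‖ ≤ 1 + Real.exp 1 := by
    have h1 : ‖Q‖ ≤ ‖Q - 1‖ + ‖(1 : 𝔄 →L[ℝ] 𝔄)‖ := by
      have := norm_add_le (Q - 1) (1 : 𝔄 →L[ℝ] 𝔄); rwa [sub_add_cancel] at this
    have h2 : ‖(1 : 𝔄 →L[ℝ] 𝔄)‖ ≤ 1 := by rw [ContinuousLinearMap.one_def]; exact ContinuousLinearMap.norm_id_le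
    have h3 : Real.exp 1 * rB * η ≤ Real.exp 1 := by
      calc Real.exp 1 * rB * η = Real.exp 1 * (η * rB) := by ring
        _ ≤ Real.exp 1 * 1 := mul_le_mul_of_nonneg_left hregB he
        _ = Real.exp 1 := mul_one _
    linarith
  have hT2 : ‖M - P * M * Q‖ ≤ η ^ 2 * (Real.exp 1 ^ 2 * (2 + Real.exp 1) * r * rB) := by
    refine (norm_conj_defect_le hPQ).trans ?_
    have a1 : ‖P - 1‖ * ‖M - 1‖ * ‖Q‖ ≤ (Real.exp 1 * rB * η) * (Real.exp 1 * r * η) * (1 + Real.exp 1) :=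
      mul_le_mul (mul_le_mul hP1 hM1 (norm_nonneg _) (by positivity)) hQn (norm_nonneg _) (by positivity)
    have a2 : ‖M - 1‖ * ‖Q - 1‖ ≤ (Real.exp 1 * r * η) * (Real.exp 1 * rB * η) := mul_le_mul hM1 hQ1 (norm_nonneg _) (by positivity)
    calc ‖P - 1‖ * ‖M - 1‖ * ‖Q‖ + ‖M - 1‖ * ‖Q - 1‖
        ≤ (Real.exp 1 * rB * η) * (Real.exp 1 * r * η) * (1 + Real.exp 1) + (Real.exp 1 * r * η) * (Real.exp 1 * rB * η) := add_le_add a1 a2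
      _ = η ^ 2 * (Real.exp 1 ^ 2 * (2 + Real.exp 1) * r * rB) := by ring
  have htot : ‖Phi0 η (Z μ x) - P * M * Q‖ ≤ η ^ 2 * (Real.exp 1 * g + Real.exp 1 ^ 2 * (2 + Real.exp 1) * r * rB) := by
    have hsplit : Phi0 η (Z μ x) - P * M * Q = (Phi0 η (Z μ x) - M) + (M - P * M * Q) := by abel
    rw [hsplit]
    refine (norm_add_le _ _).trans ?_
    calc ‖Phi0 η (Z μ x) - M‖ + ‖M - P * M * Q‖ ≤ Real.exp 1 * η * (η * g) + η ^ 2 * (Real.exp 1 ^ 2 * (2 + Real.exp 1) * r * rB) := add_le_add hT1 hT2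
      _ = η ^ 2 * (Real.exp 1 * g + Real.exp 1 ^ 2 * (2 + Real.exp 1) * r * rB) := by ring
  rw [hcoord]
  calc |coordMat e (Phi0 η (Z μ x) - P * M * Q) i j| ≤ basisConst e * ‖Phi0 η (Z μ x) - P * M * Q‖ := abs_coordMat_entry_le e _ i j
    _ ≤ basisConst e * (η ^ 2 * (Real.exp 1 * g + Real.exp 1 ^ 2 * (2 + Real.exp 1) * r * rB)) := mul_le_mul_of_nonneg_left htot (basisConst_nonneg e)
    _ = η ^ 2 * (basisConst e * (Real.exp 1 * g + Real.exp 1 ^ 2 * (2 + Real.exp 1) * r * rB)) := by ring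

end Gradient

end Summit.QuantumFields.YangMills.BalabanUVNodes.N15.CurvedSpecies

end
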